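import Summits.Ventures.PercRepro.CrossTermPlus

/-!
# PercRepro — SERIES substitution for the marked-partition law and for `Q⁺(Δ_g, Δ_g)` (typer-2, gen 4)

`LEAD-C011-concavity.md` §10.13 and ASSIGNMENTS v25 (L2), series half: an UNMARKED vertex `x` of
degree two, with edges `e₁ = {y, x}` and `e₂ = {x, z}` of weights `p₁, p₂`, is seen by the marked
partition (marks avoiding `x`) only through «both edges are open», so the pair may be replaced by
ONE edge `y–z` of weight `p₁ p₂`. An identity of the law `law4` for every `p`, hence of `deltaQuad`
along any edge `g` outside the pair (**`IsSeries.deltaQuad`**). The parallel half is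
`Parallel.lean`; together they are the substitution identity behind the induction on `|E|` that
reduces Lemma 5 to two-terminal-reduced graphs (§10.15).

* `serConfig e₁ e₂ ω` (`e₁ ↦ ω e₁ ∧ ω e₂`, `e₂ ↦ false`) and its calculus;
* `IsSeries e₁ e₂ x y z` (the degree-two condition), `seriesGraph e₁ y z` (the edge `e₁`
  re-attached to the far endpoints);
* **`IsSeries.conn_imp`** / **`IsSeries.conn_of_series`** / **`IsSeries.conn_iff`** — connectivity
  between vertices other than `x` transports to the reduced graph; `IsSeries.mem_partitionEvent_iff`;
* `serWeight p e₁ e₂ = p[e₂ := 0][e₁ := p₁ p₂]`, `serWeight_update`,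
  **`IsSeries.prob_partitionEvent`** (conditioning on the pair + flip transport), `IsSeries.law4`,
  **`IsSeries.deltaQuad`**.
-/

namespace PercRepro

/-- The reduced configuration of a series pair: `e₁` open iff both `e₁` and `e₂` were, `e₂`
closed, everything else unchanged. -/
def serConfig {E : Type*} [DecidableEq E] (e₁ e₂ : E) (ω : Config E) : Config E :=
  Function.update (Function.update ω e₂ false) e₁ (ω e₁ && ω e₂)

section SerConfig

variable {E : Type*} [DecidableEq E] {e₁ e₂ : E} (hne : e₁ ≠ e₂) (ω : Config E)
include hne

omit hne in
/-- `serConfig` at `e₁`. -/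
theorem serConfig_apply_fst : serConfig e₁ e₂ ω e₁ = (ω e₁ && ω e₂) := by
  unfold serConfig
  rw [Function.update_self]

/-- `serConfig` at `e₂`. -/
theorem serConfig_apply_snd : serConfig e₁ e₂ ω e₂ = false := by
  unfold serConfig
  rw [Function.update_of_ne hne.symm, Function.update_self]

omit hne in
/-- `serConfig` off the pair. -/
theorem serConfig_apply_of_ne {e : E} (h₁ : e ≠ e₁) (h₂ : e ≠ e₂) : serConfig e₁ e₂ ω e = ω e := by
  unfold serConfig
  rw [Function.update_of_ne h₁, Function.update_of_ne h₂]

/-- With both edges closed, `serConfig` changes nothing. -/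
theorem serConfig_eq_self (h₁ : ω e₁ = false) (h₂ : ω e₂ = false) : serConfig e₁ e₂ ω = ω := by
  funext e
  by_cases he₁ : e = e₁
  · subst he₁
    rw [serConfig_apply_fst _, h₁, Bool.false_and]
  by_cases he₂ : e = e₂
  · subst he₂
    rw [serConfig_apply_snd hne, h₂]
  · rw [serConfig_apply_of_ne ω he₁ he₂]

/-- Opening `e₂` in a configuration with `e₂` closed and reducing gives the configuration back. -/
theorem serConfig_update_snd_true (h₂ : ω e₂ = false) :
    serConfig e₁ e₂ (Function.update ω e₂ true) = ω := by
  funext e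
  by_cases he₁ : e = e₁
  · subst he₁
    rw [serConfig_apply_fst _, Function.update_of_ne hne, Function.update_self, Bool.and_true]
  by_cases he₂ : e = e₂
  · subst he₂
    rw [serConfig_apply_snd hne, h₂]
  · rw [serConfig_apply_of_ne _ he₁ he₂, Function.update_of_ne he₂]

/-- Opening `e₁` in a configuration with both edges closed and reducing gives it back. -/
theorem serConfig_update_fst_true (h₁ : ω e₁ = false) (h₂ : ω e₂ = false) :
    serConfig e₁ e₂ (Function.update ω e₁ true) = ω := by
  funext e
  by_cases he₁ : e = e₁
  · subst he₁
    rw [serConfig_apply_fst _, Function.update_self, Function.update_of_ne hne.symm, h₂,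
      Bool.and_false, h₁]
  by_cases he₂ : e = e₂
  · subst he₂
    rw [serConfig_apply_snd hne, h₂]
  · rw [serConfig_apply_of_ne _ he₁ he₂, Function.update_of_ne he₁]

end SerConfig

namespace MultiGraph

variable {V E : Type*} (G : MultiGraph V E)

/-- `x` is an internal SERIES vertex of the pair `(e₁, e₂)` with far endpoints `y`, `z`:
`e₁ = {y, x}` and `e₂ = {x, z}` are its only incident edges and neither is a loop at `x`. -/
structure IsSeries (e₁ e₂ : E) (x y z : V) : Prop where
  ne : e₁ ≠ e₂
  end₁ : (G.fst e₁ = y ∧ G.snd e₁ = x) ∨ (G.fst e₁ = x ∧ G.snd e₁ = y)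
  end₂ : (G.fst e₂ = x ∧ G.snd e₂ = z) ∨ (G.fst e₂ = z ∧ G.snd e₂ = x)
  yx : y ≠ x
  zx : z ≠ x
  deg : ∀ e, G.fst e = x ∨ G.snd e = x → e = e₁ ∨ e = e₂

variable {G}

/-- `e₁` open joins `y` and `x`. -/
theorem IsSeries.conn_y_x {e₁ e₂ : E} {x y z : V} (hs : G.IsSeries e₁ e₂ x y z) {ω : Config E}
    (h₁ : ω e₁ = true) : G.Conn ω y x := by
  have h := Conn.of_openAdj (G.openAdj_of_open e₁ h₁)
  rcases hs.end₁ with ⟨ha, hb⟩ | ⟨ha, hb⟩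
  · rwa [ha, hb] at h
  · rw [ha, hb] at h
    exact h.symm

/-- `e₂` open joins `x` and `z`. -/
theorem IsSeries.conn_x_z {e₁ e₂ : E} {x y z : V} (hs : G.IsSeries e₁ e₂ x y z) {ω : Config E}
    (h₂ : ω e₂ = true) : G.Conn ω x z := by
  have h := Conn.of_openAdj (G.openAdj_of_open e₂ h₂)
  rcases hs.end₂ with ⟨ha, hb⟩ | ⟨ha, hb⟩
  · rwa [ha, hb] at h
  · rw [ha, hb] at h
    exact h.symm

/-- An edge other than `e₁`, `e₂` avoids `x`. -/
theorem IsSeries.ne_of_ne {e₁ e₂ : E} {x y z : V} (hs : G.IsSeries e₁ e₂ x y z) {e : E}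
    (h₁ : e ≠ e₁) (h₂ : e ≠ e₂) : G.fst e ≠ x ∧ G.snd e ≠ x := by
  constructor
  · intro h
    rcases hs.deg e (Or.inl h) with h' | h'
    · exact h₁ h'
    · exact h₂ h'
  · intro h
    rcases hs.deg e (Or.inr h) with h' | h'
    · exact h₁ h'
    · exact h₂ h'

variable (G) [DecidableEq E]

/-- The reduced graph of a series pair: the edge `e₁` is re-attached to the far endpoints `y`, `z`
(`e₂` keeps its endpoints; it is deleted by weight `0`). -/
def seriesGraph (e₁ : E) (y z : V) : MultiGraph V E :=
  { fst := Function.update G.fst e₁ y, snd := Function.update G.snd e₁ z }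

/-- In the reduced graph `e₁` starts at `y`. -/
theorem seriesGraph_fst_self (e₁ : E) (y z : V) : (G.seriesGraph e₁ y z).fst e₁ = y :=
  Function.update_self _ _ _

/-- In the reduced graph `e₁` ends at `z`. -/
theorem seriesGraph_snd_self (e₁ : E) (y z : V) : (G.seriesGraph e₁ y z).snd e₁ = z :=
  Function.update_self _ _ _

/-- The other edges keep their first endpoint. -/
theorem seriesGraph_fst_of_ne {e e₁ : E} (h : e ≠ e₁) (y z : V) :
    (G.seriesGraph e₁ y z).fst e = G.fst e :=
  Function.update_of_ne h _ _

/-- The other edges keep their second endpoint. -/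
theorem seriesGraph_snd_of_ne {e e₁ : E} (h : e ≠ e₁) (y z : V) :
    (G.seriesGraph e₁ y z).snd e = G.snd e :=
  Function.update_of_ne h _ _

variable {G}

/-- **Series reduction, forward**: a path of `G` from a vertex `u ≠ x` is tracked in the reduced
graph: at a vertex `w ≠ x` it is there; at `x` it has reached `y` (if it came through `e₁`) and `z`
(if through `e₂`). -/
theorem IsSeries.conn_imp {e₁ e₂ : E} {x y z : V} (hs : G.IsSeries e₁ e₂ x y z) (ω : Config E)
    {u : V} (hu : u ≠ x) {w : V} (h : G.Conn ω u w) :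
    (w ≠ x → (G.seriesGraph e₁ y z).Conn (serConfig e₁ e₂ ω) u w) ∧
      (w = x → (ω e₁ = true → (G.seriesGraph e₁ y z).Conn (serConfig e₁ e₂ ω) u y) ∧
        (ω e₂ = true → (G.seriesGraph e₁ y z).Conn (serConfig e₁ e₂ ω) u z)) := by
  unfold Conn at h
  induction h with
  | refl => exact ⟨fun _ => Conn.refl _ _ _, fun hux => absurd hux hu⟩
  | @tail w₁ w₂ _ hadj ih =>
    obtain ⟨e, he, hend⟩ := hadj
    -- with both `e₁`, `e₂` open the reduced edge `e₁` joins `y` and `z`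
    have hyz : ω e₁ = true → ω e₂ = true →
        (G.seriesGraph e₁ y z).OpenAdj (serConfig e₁ e₂ ω) y z := fun h₁ h₂ =>
      ⟨e₁, by simp only [serConfig_apply_fst, h₁, h₂, Bool.and_self],
        Or.inl ⟨G.seriesGraph_fst_self e₁ y z, G.seriesGraph_snd_self e₁ y z⟩⟩
    by_cases he₁ : e = e₁
    · rw [he₁] at he hend
      have hc : (w₁ = y ∧ w₂ = x) ∨ (w₁ = x ∧ w₂ = y) := by
        rcases hs.end₁ with ⟨h1, h2⟩ | ⟨h1, h2⟩ <;> rcases hend with ⟨h3, h4⟩ | ⟨h3, h4⟩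
        · exact Or.inl ⟨h3.symm.trans h1, h4.symm.trans h2⟩
        · exact Or.inr ⟨h4.symm.trans h2, h3.symm.trans h1⟩
        · exact Or.inr ⟨h3.symm.trans h1, h4.symm.trans h2⟩
        · exact Or.inl ⟨h4.symm.trans h2, h3.symm.trans h1⟩
      rcases hc with ⟨h1, h2⟩ | ⟨h1, h2⟩
      · -- from `y` into `x`
        have huy : (G.seriesGraph e₁ y z).Conn (serConfig e₁ e₂ ω) u y := by
          have h := ih.1 (by rw [h1]; exact hs.yx)
          rwa [h1] at h
        refine ⟨fun hne => absurd h2 hne, fun _ => ⟨fun _ => huy, fun hω₂ => ?_⟩⟩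
        exact huy.trans (Conn.of_openAdj (hyz he hω₂))
      · -- from `x` out to `y`
        refine ⟨fun _ => ?_, fun hx => absurd (h2 ▸ hx) hs.yx⟩
        rw [h2]
        exact (ih.2 h1).1 he
    by_cases he₂ : e = e₂
    · rw [he₂] at he hend
      have hc : (w₁ = x ∧ w₂ = z) ∨ (w₁ = z ∧ w₂ = x) := by
        rcases hs.end₂ with ⟨h1, h2⟩ | ⟨h1, h2⟩ <;> rcases hend with ⟨h3, h4⟩ | ⟨h3, h4⟩
        · exact Or.inl ⟨h3.symm.trans h1, h4.symm.trans h2⟩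
        · exact Or.inr ⟨h4.symm.trans h2, h3.symm.trans h1⟩
        · exact Or.inr ⟨h3.symm.trans h1, h4.symm.trans h2⟩
        · exact Or.inl ⟨h4.symm.trans h2, h3.symm.trans h1⟩
      rcases hc with ⟨h1, h2⟩ | ⟨h1, h2⟩
      · -- from `x` out to `z`
        refine ⟨fun _ => ?_, fun hx => absurd (h2 ▸ hx) hs.zx⟩
        rw [h2]
        exact (ih.2 h1).2 he
      · -- from `z` into `x`
        have huz : (G.seriesGraph e₁ y z).Conn (serConfig e₁ e₂ ω) u z := by
          have h := ih.1 (by rw [h1]; exact hs.zx)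
          rwa [h1] at h
        refine ⟨fun hne => absurd h2 hne, fun _ => ⟨fun hω₁ => ?_, fun _ => huz⟩⟩
        exact huz.trans (Conn.of_openAdj (hyz hω₁ he)).symm
    · -- an edge avoiding `x`: the same step in the reduced graph
      have hx := hs.ne_of_ne he₁ he₂
      have hw₁ : w₁ ≠ x := by
        rcases hend with ⟨h3, -⟩ | ⟨-, h4⟩
        · exact h3 ▸ hx.1
        · exact h4 ▸ hx.2
      have hw₂ : w₂ ≠ x := by
        rcases hend with ⟨-, h4⟩ | ⟨h3, -⟩
        · exact h4 ▸ hx.2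
        · exact h3 ▸ hx.1
      have hadj' : (G.seriesGraph e₁ y z).OpenAdj (serConfig e₁ e₂ ω) w₁ w₂ := by
        refine ⟨e, by rw [serConfig_apply_of_ne ω he₁ he₂]; exact he, ?_⟩
        rw [G.seriesGraph_fst_of_ne he₁, G.seriesGraph_snd_of_ne he₁]
        exact hend
      exact ⟨fun _ => (ih.1 hw₁).trans (Conn.of_openAdj hadj'), fun hx₂ => absurd hx₂ hw₂⟩

/-- **Series reduction, backward**: connectivity in the reduced graph gives connectivity in `G`. -/
theorem IsSeries.conn_of_series {e₁ e₂ : E} {x y z : V} (hs : G.IsSeries e₁ e₂ x y z)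
    (ω : Config E) {u w : V} (h : (G.seriesGraph e₁ y z).Conn (serConfig e₁ e₂ ω) u w) :
    G.Conn ω u w := by
  unfold Conn at h
  induction h with
  | refl => exact Conn.refl _ _ _
  | @tail w₁ w₂ _ hadj ih =>
    refine ih.trans ?_
    obtain ⟨e, he, hend⟩ := hadj
    by_cases he₁ : e = e₁
    · rw [he₁] at he hend
      rw [serConfig_apply_fst _, Bool.and_eq_true] at he
      have hyz : G.Conn ω y z := (hs.conn_y_x he.1).trans (hs.conn_x_z he.2)
      rw [G.seriesGraph_fst_self, G.seriesGraph_snd_self] at hend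
      rcases hend with ⟨h3, h4⟩ | ⟨h3, h4⟩
      · rw [← h3, ← h4]
        exact hyz
      · rw [← h3, ← h4]
        exact hyz.symm
    by_cases he₂ : e = e₂
    · rw [he₂, serConfig_apply_snd hs.ne] at he
      exact absurd he Bool.false_ne_true
    · rw [serConfig_apply_of_ne ω he₁ he₂] at he
      rw [G.seriesGraph_fst_of_ne he₁, G.seriesGraph_snd_of_ne he₁] at hend
      exact Conn.of_openAdj ⟨e, he, hend⟩

/-- **Series substitution for connectivity** between vertices other than `x`. -/
theorem IsSeries.conn_iff {e₁ e₂ : E} {x y z : V} (hs : G.IsSeries e₁ e₂ x y z) (ω : Config E)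
    {u w : V} (hu : u ≠ x) (hw : w ≠ x) :
    G.Conn ω u w ↔ (G.seriesGraph e₁ y z).Conn (serConfig e₁ e₂ ω) u w :=
  ⟨fun h => (hs.conn_imp ω hu h).1 hw, hs.conn_of_series ω⟩

/-- **Series substitution for a partition row** of marks avoiding `x`. -/
theorem IsSeries.mem_partitionEvent_iff {e₁ e₂ : E} {x y z : V} (hs : G.IsSeries e₁ e₂ x y z)
    (ω : Config E) {k : ℕ} {m : Fin k → V} (hm : ∀ i, m i ≠ x) (rgs : Fin k → ℕ) :
    ω ∈ G.partitionEvent m rgs ↔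
      serConfig e₁ e₂ ω ∈ (G.seriesGraph e₁ y z).partitionEvent m rgs := by
  simp only [partitionEvent, Set.mem_setOf_eq]
  exact forall_congr' fun i => forall_congr' fun j => by rw [hs.conn_iff ω (hm i) (hm j)]

end MultiGraph

/-- The SERIES substitution weights: `e₂` deleted, `e₁` of weight `p₁ p₂`. -/
noncomputable def serWeight {E : Type*} [DecidableEq E] (p : E → ℝ) (e₁ e₂ : E) : E → ℝ :=
  Function.update (Function.update p e₂ 0) e₁ (p e₁ * p e₂)

/-- The series substitution commutes with fixing the weight of an edge outside the pair. -/
theorem serWeight_update {E : Type*} [DecidableEq E] (p : E → ℝ) {e₁ e₂ g : E}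
    (hg₁ : g ≠ e₁) (hg₂ : g ≠ e₂) (t : ℝ) :
    serWeight (Function.update p g t) e₁ e₂ = Function.update (serWeight p e₁ e₂) g t := by
  unfold serWeight
  rw [Function.update_of_ne hg₁.symm, Function.update_of_ne hg₂.symm,
    Function.update_comm hg₂ t 0 p, Function.update_comm hg₁ t (p e₁ * p e₂) (Function.update p e₂ 0)]

namespace MultiGraph

variable {V E : Type*} {G : MultiGraph V E} [Fintype E] [DecidableEq E]

/-- **Series substitution for the partition law**: an unmarked vertex `x` of degree two with edges
of weights `p₁, p₂` is one edge `y–z` of weight `p₁ p₂`. -/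
theorem IsSeries.prob_partitionEvent {e₁ e₂ : E} {x y z : V} (hs : G.IsSeries e₁ e₂ x y z)
    (p : E → ℝ) {k : ℕ} {m : Fin k → V} (hm : ∀ i, m i ≠ x) (rgs : Fin k → ℕ) :
    prob p (G.partitionEvent m rgs) =
      prob (serWeight p e₁ e₂) ((G.seriesGraph e₁ y z).partitionEvent m rgs) := by
  have hne := hs.ne
  have hmem := fun ω => hs.mem_partitionEvent_iff ω hm rgs
  -- both open in `G` = `e₁` open in the reduced graph
  have hF11 : prob (Function.update (Function.update p e₂ 1) e₁ 1) (G.partitionEvent m rgs) =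
      prob (Function.update (Function.update p e₂ 0) e₁ 1)
        ((G.seriesGraph e₁ y z).partitionEvent m rgs) := by
    rw [Function.update_comm hne.symm 1 1 p, prob_update_one_eq_prob_update_zero_preimage,
      Function.update_comm hne 1 0 p]
    refine prob_congr_of_support _ fun ω hw => ?_
    have h₂ : ω e₂ = false := eq_false_of_weight_ne_zero_of_eq_zero hw
      (by rw [Function.update_of_ne hne.symm, Function.update_self])
    rw [Set.mem_preimage, PercRepro.flipEdge, h₂, Bool.not_false, hmem, serConfig_update_snd_true hne ω h₂]
  -- exactly one open, or none: `e₁` closed in the reduced graph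
  have hF01 : prob (Function.update (Function.update p e₂ 1) e₁ 0) (G.partitionEvent m rgs) =
      prob (Function.update (Function.update p e₂ 0) e₁ 0)
        ((G.seriesGraph e₁ y z).partitionEvent m rgs) := by
    rw [Function.update_comm hne.symm 1 0 p, prob_update_one_eq_prob_update_zero_preimage,
      Function.update_comm hne 0 0 p]
    refine prob_congr_of_support _ fun ω hw => ?_
    have h₂ : ω e₂ = false := eq_false_of_weight_ne_zero_of_eq_zero hw
      (by rw [Function.update_of_ne hne.symm, Function.update_self])
    rw [Set.mem_preimage, PercRepro.flipEdge, h₂, Bool.not_false, hmem, serConfig_update_snd_true hne ω h₂]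
  have hF10 : prob (Function.update (Function.update p e₂ 0) e₁ 1) (G.partitionEvent m rgs) =
      prob (Function.update (Function.update p e₂ 0) e₁ 0)
        ((G.seriesGraph e₁ y z).partitionEvent m rgs) := by
    rw [prob_update_one_eq_prob_update_zero_preimage]
    refine prob_congr_of_support _ fun ω hw => ?_
    have h₁ : ω e₁ = false := eq_false_of_weight_ne_zero_of_eq_zero hw (Function.update_self _ _ _)
    have h₂ : ω e₂ = false := eq_false_of_weight_ne_zero_of_eq_zero hw
      (by rw [Function.update_of_ne hne.symm, Function.update_self])
    rw [Set.mem_preimage, PercRepro.flipEdge, h₁, Bool.not_false, hmem, serConfig_update_fst_true hne ω h₁ h₂]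
  have hF00 : prob (Function.update (Function.update p e₂ 0) e₁ 0) (G.partitionEvent m rgs) =
      prob (Function.update (Function.update p e₂ 0) e₁ 0)
        ((G.seriesGraph e₁ y z).partitionEvent m rgs) := by
    refine prob_congr_of_support _ fun ω hw => ?_
    have h₁ : ω e₁ = false := eq_false_of_weight_ne_zero_of_eq_zero hw (Function.update_self _ _ _)
    have h₂ : ω e₂ = false := eq_false_of_weight_ne_zero_of_eq_zero hw
      (by rw [Function.update_of_ne hne.symm, Function.update_self])
    rw [hmem, serConfig_eq_self hne ω h₁ h₂]
  have hL : prob p (G.partitionEvent m rgs) = p e₂ *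
      (p e₁ * prob (Function.update (Function.update p e₂ 1) e₁ 1) (G.partitionEvent m rgs) +
        (1 - p e₁) * prob (Function.update (Function.update p e₂ 1) e₁ 0) (G.partitionEvent m rgs)) +
      (1 - p e₂) *
      (p e₁ * prob (Function.update (Function.update p e₂ 0) e₁ 1) (G.partitionEvent m rgs) +
        (1 - p e₁) * prob (Function.update (Function.update p e₂ 0) e₁ 0) (G.partitionEvent m rgs)) := by
    rw [prob_split p e₂, prob_split (Function.update p e₂ 1) e₁,
      prob_split (Function.update p e₂ 0) e₁, Function.update_of_ne hne, Function.update_of_ne hne]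
  have hR : prob (serWeight p e₁ e₂) ((G.seriesGraph e₁ y z).partitionEvent m rgs) =
      p e₁ * p e₂ * prob (Function.update (Function.update p e₂ 0) e₁ 1)
        ((G.seriesGraph e₁ y z).partitionEvent m rgs) +
      (1 - p e₁ * p e₂) * prob (Function.update (Function.update p e₂ 0) e₁ 0)
        ((G.seriesGraph e₁ y z).partitionEvent m rgs) := by
    rw [prob_split (serWeight p e₁ e₂) e₁]
    unfold serWeight
    rw [Function.update_idem, Function.update_idem, Function.update_self]
  rw [hL, hR, hF11, hF01, hF10, hF00]
  ring

/-- **Series substitution for the law `law4`** (marks avoiding `x`). -/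
theorem IsSeries.law4 {e₁ e₂ : E} {x y z : V} (hs : G.IsSeries e₁ e₂ x y z) (p : E → ℝ)
    {a b c d : V} (ha : a ≠ x) (hb : b ≠ x) (hc : c ≠ x) (hd : d ≠ x) :
    G.law4 p a b c d = (G.seriesGraph e₁ y z).law4 (serWeight p e₁ e₂) a b c d :=
  funext fun _ => hs.prob_partitionEvent p
    (fun i => by fin_cases i <;> simp [ha, hb, hc, hd]) _

/-- **Series substitution for `Q⁺(Δ_g, Δ_g)`** along any edge `g` outside the pair. -/
theorem IsSeries.deltaQuad {e₁ e₂ : E} {x y z : V} (hs : G.IsSeries e₁ e₂ x y z) (p : E → ℝ)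
    {g : E} (hg₁ : g ≠ e₁) (hg₂ : g ≠ e₂) {a b c d : V} (ha : a ≠ x) (hb : b ≠ x) (hc : c ≠ x)
    (hd : d ≠ x) :
    G.deltaQuad p g a b c d = (G.seriesGraph e₁ y z).deltaQuad (serWeight p e₁ e₂) g a b c d := by
  unfold MultiGraph.deltaQuad
  rw [hs.law4 (Function.update p g 1) ha hb hc hd, hs.law4 (Function.update p g 0) ha hb hc hd,
    serWeight_update p hg₁ hg₂, serWeight_update p hg₁ hg₂]

end MultiGraph

end PercRepro
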